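import Summits.BirchSwinnertonDyer.BirchSwinnertonDyer.Theses.AdditiveBranchIMC
import HarnessLib

/-! BC3 birth skeleton for crux `AdditiveBranchIMC.MultLower` (route AdditiveBranchIMC, rung K1):
v2 (A12-admitted shape, planner g12): named stubs (the ONLY sorried declarations) + the kernel-checked composition `MultLower_of` concluding the crux BY NAME. -/

set_option autoImplicit false

set_option linter.dupNamespace false

namespace Summit.BirchSwinnertonDyer.BirchSwinnertonDyer.Cruxes.MultLower.Birth

open scoped Classical

open WeierstrassCurve Literature.NumberTheory.EllipticCurves
  Literature.NumberTheory.EllipticCurves.ModularForms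
  Literature.NumberTheory.EllipticCurves.GreenbergVatsal2000
  Literature.NumberTheory.EllipticCurves.Rank1Residual
  Literature.NumberTheory.EllipticCurves.Rank1Residual.Typed
  Literature.NumberTheory.GaloisRepresentations
  IsDedekindDomain NumberField

open Summit.BirchSwinnertonDyer.Rank1Residual.Additive
open Summit.BirchSwinnertonDyer.BirchSwinnertonDyer.Theses.AdditiveBranchIMC

/-- stub (rankZero): cell (M), analytic rank 0: Delbourgo 1998 (M)-measure Main Conjecture ⊆(𝓛) at T = 0 on the ω^{(p−1)/2}-branch of the multiplicative-at-p twist (exceptional-zero interaction at T = 0; Skinner 2016 covers only the trivial branch). -/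
theorem stub_rankZero :
    ∀ (W : WeierstrassCurve ℚ) [W.IsElliptic] [W.IsGloballyMinimal] (p : ℕ) [Fact p.Prime],
      W.analyticRank = 0 → N10.CellM W p → MissingLowerBoundAt W p := by
  sorry

/-- stub (rankOne): cell (M), analytic rank 1: branch ⊆(𝓛) in rank 1 + `BranchPAdicGrossZagierMultAt` (p-adic GZ for the multiplicative twist on the branch, 𝓛-invariant) + Schneider. -/
theorem stub_rankOne :
    ∀ (W : WeierstrassCurve ℚ) [W.IsElliptic] [W.IsGloballyMinimal] (p : ℕ) [Fact p.Prime],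
      W.analyticRank = 1 → N10.CellM W p → MissingLowerBoundAt W p := by
  sorry

/-- BC3 composition = THE SKELETON (A12 shape, v2): the crux BY NAME with NO hypotheses, from exactly the two
registered stubs (analytic rank 0 / 1 on cell (M)); kernel-checked, no sorry of its own. -/
theorem MultLower_of :
    Summit.BirchSwinnertonDyer.BirchSwinnertonDyer.Theses.AdditiveBranchIMC.MultLower := by
  intro W _ _ p _ hr hc
  rcases Nat.le_one_iff_eq_zero_or_eq_one.mp hr with h | h
  · exact stub_rankZero W p h hc
  · exact stub_rankOne W p h hc

end Summit.BirchSwinnertonDyer.BirchSwinnertonDyer.Cruxes.MultLower.Birth
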